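import Mathlib
import Summits.ResolutionOfSingularities.ResolutionOfSingularities.Theorems.RadicialJungCleanModelsContactChainL7b
import Summits.ResolutionOfSingularities.ResolutionOfSingularities.Theorems.RadicialJungCleanModelsContactChainOffPointTransport
import Summits.ResolutionOfSingularities.ResolutionOfSingularities.Theorems.RadicialJungCleanModelsContactChainUniquePoint
import Summits.ResolutionOfSingularities.ResolutionOfSingularities.Theorems.RadicialJungCleanModelsGenericSpreadSchemeFinite
import HarnessLib

/-!
# Route `RadicialJung`, crux `CleanModels` (stmt-ResolutionOfSingularities-15917), line `Sketch` rev 35, stub 6 `stub_cleanProp44` (X44c),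
# work plan O8 / L7b-global: the DESCENT STEP — one chain of point blow-ups at a bad point strictly decreases the (finite) bad set

Memo `Cruxes/CleanModels/Lines/Sketch-memo-hand2-g9-stubs-5-7.md` §3a/§3b.  With the bad set finite (✓ `finite_setOf_not_cleanPermissibleAt_of_cleanRegAt_genericPoint`,
`…GenericSpreadSchemeFinite.lean`), L7b-global is an induction on its cardinality; this file proves the induction STEP in the currency of
✓ `IsPointChainAlong`: on a regular integral locally Noetherian quasi-excellent `X₀` (`char p`), for a regular curve `C₀ = cl{η}` whose
non-generic points are closed with `dim 𝒪 = 3`, a bad point `x₀ ≠ η` (the line of `G` not clean-permissible for `C₀` at `x₀`) at which the line is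
clean-regular, L7b's chain `σ : X → X₀` (✓ p816242) ends at a point where `σ^♯G` IS clean-permissible for the strict transform `C`, and then
`Bad(C, σ^♯G)` injects by `σ` into `Bad(C₀, G) ∖ {x₀}` — the end point is the only point of `C` over `x₀` (✓ p816640), `σ` is injective off `x₀`
(✓ p816363) and clean-permissibility is transported there (✓ p816554) — so `#Bad(C) < #Bad(C₀)` (`exists_pointChain_ncard_bad_lt`).

Honest framing: OURS (bookkeeping); the persistence of the one-dimensionality / dimension-3 / clean-regularity data along the chain (for iterating)
and the output predicate (O6) remain; nothing here proves X44c or any case of `CleanModels`.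
-/

noncomputable section

set_option linter.dupNamespace false -- mandated namespace of this single-conjunct summit

open CategoryTheory AlgebraicGeometry TopologicalSpace IsLocalRing Opposite
open Literature.AlgebraicGeometry.Resolution Literature.AlgebraicGeometry.Motives
open Scheme.IdealSheafData

namespace Summit.ResolutionOfSingularities.ResolutionOfSingularities.Theorems.RadicialJung.CleanModels

universe u

/-- A morphism which restricts to an isomorphism over an open `U` is injective on `f⁻¹ U`. [folklore] -/
theorem injOn_preimage_of_isIso_morphismRestrict {X Y : Scheme.{u}} (f : X ⟶ Y) (U : Y.Opens) [IsIso (f ∣_ U)] :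
    Set.InjOn (fun x => f x) (f ⁻¹ᵁ U : Set X) := by
  intro a ha b hb hab
  let e := asIso (f ∣_ U)
  have h1 : (f ∣_ U) ⟨a, ha⟩ = (f ∣_ U) ⟨b, hb⟩ := by
    apply Subtype.ext
    rw [morphismRestrict_base_coe, morphismRestrict_base_coe]
    exact hab
  have h2 := congrArg e.inv h1
  simp [e, ← Scheme.Hom.comp_apply] at h2
  first
  | exact h2
  | exact congrArg Subtype.val h2

/-- At a point of a regular curve on a scheme with three-dimensional local ring there, a transversal parameter: `𝓘_{C₀,x₀} + (w) = 𝔪`. [folklore] -/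
theorem exists_transversal_of_isRsopPart_pair {X₀ : Scheme.{u}} {C₀ : Closeds X₀} {x₀ : X₀} (c : Fin 2 → X₀.presheaf.stalk x₀)
    (hc : IsRsopPart c) (hcI : Ideal.span (Set.range c) = stalkIdeal (vanishingIdeal C₀) x₀) (hdim : ringKrullDim (X₀.presheaf.stalk x₀) = 3) :
    ∃ w : X₀.presheaf.stalk x₀, stalkIdeal (vanishingIdeal C₀) x₀ ⊔ Ideal.span {w} = maximalIdeal _ := by
  obtain ⟨_, e, y, hde, hspan⟩ := hc
  have he : e = 1 := by
    rw [hdim] at hde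
    have : (3 : ℕ) = 2 + e := by exact_mod_cast hde
    omega
  subst he
  refine ⟨y 0, ?_⟩
  rw [← hcI, ← hspan, Ideal.span_union]
  congr 2
  ext z
  simp only [Set.mem_range, Set.mem_singleton_iff]
  constructor
  · rintro rfl; exact ⟨0, rfl⟩
  · rintro ⟨i, hi⟩; rw [← hi, Fin.eq_zero i]

/-- **The descent step of L7b-global.**  See the module docstring. [cite: CossartPiltant2008, Prop. 4.4 (proof, p. 10)]
[cite: Piltant2013, §2 Axiom 4] [cite: CossartJannsenSaito2020, proof of Thm. 6.28, Step 5] -/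
theorem exists_pointChain_ncard_bad_lt {X₀ : Scheme.{0}} [IsIntegral X₀] [IsLocallyNoetherian X₀] (hX₀ : Scheme.IsRegular X₀)
    (hE : Scheme.IsQuasiExcellent X₀) (p : ℕ) [hp : Fact p.Prime] [CharP X₀.functionField p] {C₀ : Closeds X₀}
    (hC₀reg : ∀ y ∈ (C₀ : Set X₀), ∃ c : Fin 2 → X₀.presheaf.stalk y,
      IsRsopPart c ∧ Ideal.span (Set.range c) = stalkIdeal (vanishingIdeal C₀) y)
    {η : X₀} (hη : (C₀ : Set X₀) = closure {η}) (hcl : ∀ y ∈ (C₀ : Set X₀), y ≠ η → IsClosed ({y} : Set X₀))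
    (hdim3 : ∀ y ∈ (C₀ : Set X₀), y ≠ η → ringKrullDim (X₀.presheaf.stalk y) = 3) (G : X₀.functionField)
    (hfin : {y : X₀ | y ∈ (C₀ : Set X₀) ∧ ¬ CleanPermissibleAt p (RatFn.toFunctionField y) G (stalkIdeal (vanishingIdeal C₀) y)}.Finite)
    {x₀ : X₀} (hx₀C : x₀ ∈ (C₀ : Set X₀)) (hx₀η : x₀ ≠ η)
    (hx₀bad : ¬ CleanPermissibleAt p (RatFn.toFunctionField x₀) G (stalkIdeal (vanishingIdeal C₀) x₀))
    (hGx₀ : CleanRegAt p (RatFn.toFunctionField x₀) G) :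
    ∃ (X : Scheme.{0}) (_ : IsIntegral X) (_ : IsLocallyNoetherian X) (σ : X ⟶ X₀) (_ : IsDominant σ) (C : Closeds X) (x : X) (n : ℕ),
      IsPointChainAlong σ C₀ C x n ∧ σ x = x₀ ∧ IsClosed ({x} : Set X) ∧
      {y : X | y ∈ (C : Set X) ∧
        ¬ CleanPermissibleAt p (RatFn.toFunctionField y) (RatFn.functionFieldMap σ G) (stalkIdeal (vanishingIdeal C) y)}.Finite ∧
      {y : X | y ∈ (C : Set X) ∧
        ¬ CleanPermissibleAt p (RatFn.toFunctionField y) (RatFn.functionFieldMap σ G) (stalkIdeal (vanishingIdeal C) y)}.ncard <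
      {y : X₀ | y ∈ (C₀ : Set X₀) ∧ ¬ CleanPermissibleAt p (RatFn.toFunctionField y) G (stalkIdeal (vanishingIdeal C₀) y)}.ncard := by
  classical
  have hx₀cl : IsClosed ({x₀} : Set X₀) := hcl x₀ hx₀C hx₀η
  have hdim₀ : ringKrullDim (X₀.presheaf.stalk x₀) = 3 := hdim3 x₀ hx₀C hx₀η
  haveI : IsRegularLocalRing (X₀.presheaf.stalk x₀) := hX₀ x₀
  obtain ⟨c2, hc2, hc2P⟩ := hC₀reg x₀ hx₀C
  -- `𝓘_{C₀,x₀}` is prime (it is the prime of the generisation `η ⤳ x₀`)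
  have hspec₀ : η ⤳ x₀ := by rw [specializes_iff_mem_closure, ← hη]; exact hx₀C
  have hC₀eq : C₀ = ⟨closure {η}, isClosed_closure⟩ := Closeds.ext hη
  haveI hP : (stalkIdeal (vanishingIdeal C₀) x₀).IsPrime := by
    have h1 : stalkIdeal (vanishingIdeal C₀) x₀ = primeOfSpecializes hspec₀ := by
      have := stalkIdeal_vanishingIdeal_closure (X := X₀) hspec₀
      rwa [← hC₀eq] at this
    rw [h1]; infer_instance
  obtain ⟨w, hw⟩ := exists_transversal_of_isRsopPart_pair c2 hc2 hc2P hdim₀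
  -- L7b at `x₀`
  obtain ⟨X, hXi, hXn, σ, hσd, C, x, n, hchain, hσx, hxcl, hperm⟩ :=
    exists_pointChain_cleanPermissibleAt_of_cleanRegAt hX₀ hE p hC₀reg hx₀cl hx₀C hdim₀ w hw G hGx₀
  refine ⟨X, hXi, hXn, σ, hσd, C, x, n, hchain, hσx, hxcl, ?_⟩
  subst hσx
  set Bad₀ := {y : X₀ | y ∈ (C₀ : Set X₀) ∧ ¬ CleanPermissibleAt p (RatFn.toFunctionField y) G (stalkIdeal (vanishingIdeal C₀) y)}
    with hBad₀
  set Bad := {y : X | y ∈ (C : Set X) ∧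
    ¬ CleanPermissibleAt p (RatFn.toFunctionField y) (RatFn.functionFieldMap σ G) (stalkIdeal (vanishingIdeal C) y)} with hBad
  -- every bad point of `C` lies over a bad point of `C₀` other than `σ x`
  have hover : ∀ y ∈ Bad, σ y ∈ Bad₀ \ {σ x} := by
    rintro y ⟨hyC, hybad⟩
    have hne : σ y ≠ σ x := by
      intro heq
      have hyx : y = x := hchain.eq_of_mem_of_eq hX₀ hC₀reg hx₀C hdim₀ y hyC heq
      rw [hyx] at hybad
      exact hybad hperm
    have hyC₀ : σ y ∈ (C₀ : Set X₀) := by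
      have h1 : y ∈ (C : Set X) ∩ σ ⁻¹' {σ x}ᶜ := ⟨hyC, hne⟩
      rw [hchain.inter_preimage_compl hx₀cl] at h1
      exact h1.1
    refine ⟨⟨hyC₀, fun hgood => hybad (hchain.cleanPermissibleAt_of_ne hx₀cl p G y hne hgood)⟩, hne⟩
  -- `σ` is injective on the bad set (an isomorphism off `σ x`)
  set U : X₀.Opens := ⟨{σ x}ᶜ, hx₀cl.isOpen_compl⟩ with hU
  haveI : IsIso (σ ∣_ U) := hchain.isIso_morphismRestrict U (fun h => h rfl)
  have hinj : Set.InjOn (fun y => σ y) Bad := fun a ha b hb hab =>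
    injOn_preimage_of_isIso_morphismRestrict σ U (hover a ha).2 (hover b hb).2 hab
  have hfin' : Bad.Finite :=
    Set.Finite.of_finite_image ((hfin.sdiff).subset (by rintro _ ⟨y, hy, rfl⟩; exact hover y hy)) hinj
  refine ⟨hfin', ?_⟩
  have hle : Bad.ncard ≤ (Bad₀ \ {σ x}).ncard := Set.ncard_le_ncard_of_injOn (fun y => σ y) hover hinj hfin.sdiff
  have hmem : σ x ∈ Bad₀ := ⟨hx₀C, hx₀bad⟩
  have hcard : (Bad₀ \ {σ x}).ncard + 1 = Bad₀.ncard := Set.ncard_sdiff_singleton_add_one hmem hfin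
  omega

end Summit.ResolutionOfSingularities.ResolutionOfSingularities.Theorems.RadicialJung.CleanModels

end
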